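import Summits.QuantumFields.BalabanUV.T4Continuum.Support.NE3SpreadLiftCurlLocal
import HarnessLib

/-!
# T⁴ programme, node NE3 — row E-RES♯, sub-row (R♯3b) «DRESSED SLICE LIFT — CURL», file 2: THE CORNER PLAQUETTES CARRY THE
# TRANSPLANTED COARSE CURL AT THE AVERAGED BACKGROUND, UP TO `O(a)`

NE3 (node U1b) formalisation swarm `b2b-balaban-t4-ne3-formalise-*`, leaf seat `b2b-balaban-t4-ne3-formalise-leaf-01`
(gen 4), row **E-RES♯ (R♯3b)** (owner CUT journal l.14429; FINDING F-ne3leaf01g4-1; SHAPE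
`HOME/t4/formal/NE3/Statements/E-RES-R3b-SHAPE-v1.md`; END-SIGNATURE l.14898).  File 1 = `NE3SpreadLiftCurlLocal` (p220820).

WHY.  At a fine plaquette `(x; μ, ν)` whose `μ`- AND `ν`-bonds both cross a block face (a "corner" plaquette: `x` lies in the
last `μ`-slice and the last `ν`-slice of its block `z = cdiv L x`), the four bonds of the spread lift `ψ = spreadLift L V φ` carry the
four coarse values `φ(z,μ), φ(z+e_μ,ν), φ(z+e_ν,μ), φ(z,ν)` of the coarse plaquette `(z; μ, ν)`, each dressed by the transport from
the corner of the block its bond ENTERS.  Transporting the fine curl to the frame at the block corner `L•z` along the block tree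
(`btree`), each of the four fine dressings differs from the corresponding coarse dressing by `cavg L V` (i) by the holonomy of a
CLOSED lattice word of length `≤ 8dL` (uniform loop lemma: `≤ (8dL)²·a`) and (ii) by at most three factors
`‖U(Γ_c) − V̄(c)‖ ≤ 4·loopRad` (`AveragingDeficitBlockDensity.norm_cavg_inv_bseg_sub_one_le`).  THIS FILE (0 `def`, 0 `sorry`):

§1 unitary bookkeeping (`‖B⁻¹A − 1‖ = ‖A − B‖`, products, inverses; `‖bseg − cavg‖ ≤ 4·loopRad`);
§2 word calculus (`norm_hol_sub_hol_le`: two words with the same displacement differ by `≤ (|s|+|u|)²·a`; `hol_tree_mid`);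
§3 **`norm_Ad_btree_curlAt_spreadLift_sub_le`**: for `L ≥ 1`, `d ≥ 1`, unitary `V ∈ SmallField V a`, `512(d+1)(d+4)L²a ≤ 1`:
   `‖Ad (btree L V z x) ((d_V ψ)(x; μ, ν)) − (d_{V̄} φ)(z; μ, ν)‖ ≤ K·(‖φ(z,μ)‖ + ‖φ(z+e_μ,ν)‖ + ‖φ(z+e_ν,μ)‖ + ‖φ(z,ν)‖)`,
   `K = 2·((8dL)²·a + 12·loopRad d L a)` (`≤ 512(d+4)²L²a`), and the frame-free corollary `norm_curlAt_spreadLift_corner_le`.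
(File 3 `NE3SpreadLiftCurl` does the `ℓ²` assembly over the period torus.)

HONEST FRAMING.  Kinematics of ONE averaging step at ONE background (our frame; [folklore]; context [Balaban1985Averaging]
(47)–(50) p. 25); nothing about Bałaban's minimisers; (RES♯) NOT proved; **NE3 is NOT proved**; spine PROVED 0∕9; finite T⁴ rung
(B)+1 — NOT infinite volume, NOT mass gap, NOT `BetaPertH`, NOT Clay.  PLACEMENT: `Summits/QuantumFields/BalabanUV/`; imports
`NE3SpreadLiftCurlLocal` BY NAME.  HONEST DEPENDENCY (cell page 1): continuum YM on T⁴ ⇐ BetaPertH ∧ nine spine estimates (0/9 proved);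
BetaPertH ⇐ (D1) ∧ (D4) ∧ CAP+tail; G-an2-4 gates asym, D1 and NE2/3/4.
-/

set_option autoImplicit false

open scoped BigOperators Matrix Matrix.Norms.L2Operator

namespace Summit.QuantumFields.BalabanUV.T4Continuum.NE3SpreadLiftCurlCorner

open Literature.MathematicalPhysics.QuantumFieldTheory.Balaban1983to89
open B7Prop1Explicit B7Prop2Explicit
open T4AveragingDeficitWall hiding Site Plane Plaq Bond
open T4AveragingDeficitNonAbelian (Ad_mul Ad_sub)
open AveragingDeficitNearIdentity (Ad_add)
open AveragingDeficitTransport (norm_Ad_of_unitary)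
open AveragingDeficitChartCalculus (cavg)
open SkeletonLattice (cdiv cmod smul_cdiv_add_cmod)
open SpreadLiftWords (IsCross)
open SpreadLift (loopRad loopRad_le)
open SpreadLiftDirection (spreadLift exitCorner crossHol spreadLift_of_isCross)
open AveragingDeficitBlockDensity (norm_hol_closed_sub_one_le norm_Ad_sub_Ad_le l1_cmod_le btree bseg bseg_mem cavg_mem
  norm_cavg_inv_bseg_sub_one_le)
open NE3SpreadLiftCurlLocal (isCross_add_e_iff cdiv_add_e_of_isCross add_e_sub_exitCorner crossHol_eq hol_unitary)

noncomputable section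

variable {d : ℕ} {n : Type*} [Fintype n] [DecidableEq n]

/-! ## §1 Unitary bookkeeping -/

/-- `‖B⁻¹A − 1‖ = ‖A − B‖` for unitary `B`. [folklore] -/
theorem norm_inv_mul_sub_one_eq {A B : (Matrix n n ℂ)ˣ} (hB : B ∈ unitaryUnits (Matrix n n ℂ)) :
    ‖((B⁻¹ * A : (Matrix n n ℂ)ˣ) : Matrix n n ℂ) - 1‖ = ‖(A : Matrix n n ℂ) - B‖ := by
  have e : ((B⁻¹ * A : (Matrix n n ℂ)ˣ) : Matrix n n ℂ) - 1 = ((B⁻¹ : (Matrix n n ℂ)ˣ) : Matrix n n ℂ) * ((A : Matrix n n ℂ) - B) := by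
    rw [mul_sub, Units.inv_mul, Units.val_mul]
  rw [e, CStarRing.norm_mem_unitary_mul _ (mem_unitaryUnits.mp ((unitaryUnits _).inv_mem hB))]

/-- `‖A₁A₂ − B₁B₂‖ ≤ ‖A₁ − B₁‖ + ‖A₂ − B₂‖` (`A₁`, `B₂` unitary). [folklore] -/
theorem norm_mul_sub_mul_le {A₁ A₂ B₁ B₂ : (Matrix n n ℂ)ˣ} (hA₁ : A₁ ∈ unitaryUnits (Matrix n n ℂ))
    (hB₂ : B₂ ∈ unitaryUnits (Matrix n n ℂ)) :
    ‖((A₁ * A₂ : (Matrix n n ℂ)ˣ) : Matrix n n ℂ) - (B₁ * B₂ : (Matrix n n ℂ)ˣ)‖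
      ≤ ‖(A₁ : Matrix n n ℂ) - B₁‖ + ‖(A₂ : Matrix n n ℂ) - B₂‖ := by
  have e : ((A₁ * A₂ : (Matrix n n ℂ)ˣ) : Matrix n n ℂ) - (B₁ * B₂ : (Matrix n n ℂ)ˣ)
      = ((A₁ : Matrix n n ℂ) - B₁) * (B₂ : Matrix n n ℂ) + (A₁ : Matrix n n ℂ) * ((A₂ : Matrix n n ℂ) - B₂) := by
    simp only [Units.val_mul, sub_mul, mul_sub]; abel
  rw [e]
  refine (norm_add_le _ _).trans (le_of_eq ?_)
  rw [CStarRing.norm_mul_mem_unitary _ (mem_unitaryUnits.mp hB₂), CStarRing.norm_mem_unitary_mul _ (mem_unitaryUnits.mp hA₁)]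

/-- `‖A⁻¹ − B⁻¹‖ = ‖A − B‖` for unitary `A`, `B`. [folklore] -/
theorem norm_inv_sub_inv_eq {A B : (Matrix n n ℂ)ˣ} (hA : A ∈ unitaryUnits (Matrix n n ℂ)) (hB : B ∈ unitaryUnits (Matrix n n ℂ)) :
    ‖((A⁻¹ : (Matrix n n ℂ)ˣ) : Matrix n n ℂ) - (B⁻¹ : (Matrix n n ℂ)ˣ)‖ = ‖(A : Matrix n n ℂ) - B‖ := by
  have e : ((A⁻¹ : (Matrix n n ℂ)ˣ) : Matrix n n ℂ) - (B⁻¹ : (Matrix n n ℂ)ˣ)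
      = ((A⁻¹ : (Matrix n n ℂ)ˣ) : Matrix n n ℂ) * ((B : Matrix n n ℂ) - A) * ((B⁻¹ : (Matrix n n ℂ)ˣ) : Matrix n n ℂ) := by
    rw [mul_sub, sub_mul, Units.inv_mul, one_mul, mul_assoc, Units.mul_inv, mul_one]
  rw [e, CStarRing.norm_mul_mem_unitary _ (mem_unitaryUnits.mp ((unitaryUnits _).inv_mem hB)),
    CStarRing.norm_mem_unitary_mul _ (mem_unitaryUnits.mp ((unitaryUnits _).inv_mem hA)), norm_sub_rev]

section Small

variable [Nonempty n] {L : ℕ} (hL : 1 ≤ L) {V : Site d → Fin d → (Matrix n n ℂ)ˣ} (hV : IsUnitaryCfg V) {a : ℝ} (ha : 0 ≤ a)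
  (h512 : 512 * (d + 1) * (d + 4) * (L : ℝ) ^ 2 * a ≤ 1) (hVa : SmallField V a)

include hL hV ha h512 hVa

/-- **`‖U(Γ_c) − V̄(c)‖ ≤ 4·loopRad`**: the straight transport against the averaged bond (tree `norm_cavg_inv_bseg_sub_one_le`, unframed).
[folklore] -/
theorem norm_bseg_sub_cavg_le (y : Site d) (μ : Fin d) :
    ‖((bseg L V y μ : (Matrix n n ℂ)ˣ) : Matrix n n ℂ) - (cavg L V y μ : (Matrix n n ℂ)ˣ)‖ ≤ 4 * loopRad d L a := by
  rw [← norm_inv_mul_sub_one_eq (cavg_mem hL hV ha h512 hVa y μ)]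
  exact norm_cavg_inv_bseg_sub_one_le hL hV ha h512 hVa y μ

/-- Two averaged bonds against two straight transports: `≤ 8·loopRad`. [folklore] -/
theorem norm_bseg₂_sub_cavg₂_le (y y' : Site d) (μ ν : Fin d) :
    ‖((bseg L V y μ * bseg L V y' ν : (Matrix n n ℂ)ˣ) : Matrix n n ℂ) - (cavg L V y μ * cavg L V y' ν : (Matrix n n ℂ)ˣ)‖
      ≤ 8 * loopRad d L a := by
  have h := norm_mul_sub_mul_le (A₂ := bseg L V y' ν) (B₁ := cavg L V y μ) (bseg_mem hV L y μ) (cavg_mem hL hV ha h512 hVa y' ν)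
  have h1 := norm_bseg_sub_cavg_le hL hV ha h512 hVa y μ
  have h2 := norm_bseg_sub_cavg_le hL hV ha h512 hVa y' ν
  linarith

/-- Three (the last inverted): `≤ 12·loopRad`. [folklore] -/
theorem norm_bseg₃_sub_cavg₃_le (y y' y'' : Site d) (μ ν : Fin d) :
    ‖((bseg L V y μ * bseg L V y' ν * (bseg L V y'' μ)⁻¹ : (Matrix n n ℂ)ˣ) : Matrix n n ℂ)
        - (cavg L V y μ * cavg L V y' ν * (cavg L V y'' μ)⁻¹ : (Matrix n n ℂ)ˣ)‖ ≤ 12 * loopRad d L a := by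
  have hU := (unitaryUnits (Matrix n n ℂ)).mul_mem (bseg_mem hV L y μ) (bseg_mem hV L y' ν)
  have hW := (unitaryUnits (Matrix n n ℂ)).inv_mem (cavg_mem hL hV ha h512 hVa y'' μ)
  have h := norm_mul_sub_mul_le (A₂ := (bseg L V y'' μ)⁻¹) (B₁ := cavg L V y μ * cavg L V y' ν) hU hW
  have h1 := norm_bseg₂_sub_cavg₂_le hL hV ha h512 hVa y y' μ ν
  have h2 : ‖(((bseg L V y'' μ)⁻¹ : (Matrix n n ℂ)ˣ) : Matrix n n ℂ) - ((cavg L V y'' μ)⁻¹ : (Matrix n n ℂ)ˣ)‖ ≤ 4 * loopRad d L a := by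
    rw [norm_inv_sub_inv_eq (bseg_mem hV L y'' μ) (cavg_mem hL hV ha h512 hVa y'' μ)]
    exact norm_bseg_sub_cavg_le hL hV ha h512 hVa y'' μ
  linarith

end Small

/-! ## §2 Word calculus -/

/-- **TWO WORDS WITH THE SAME DISPLACEMENT**: for unitary `V ∈ SmallField V a` and words `s`, `u` from `p` with `disp u = disp s`,
`‖V(u) − V(s)‖ ≤ (|s| + |u|)²·a` — `V(s)⁻¹V(u)` is the holonomy of the closed word `s̄ ++ u` (uniform loop lemma). [folklore] -/
theorem norm_hol_sub_hol_le [Nonempty n] {V : Site d → Fin d → (Matrix n n ℂ)ˣ} (hV : IsUnitaryCfg V) {a : ℝ} (ha : 0 ≤ a)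
    (hVa : SmallField V a) (p : Site d) (s u : List (Letter d)) (h : disp u = disp s) :
    ‖((hol V p u : (Matrix n n ℂ)ˣ) : Matrix n n ℂ) - (hol V p s : (Matrix n n ℂ)ˣ)‖ ≤ ((s.length + u.length : ℕ) : ℝ) ^ 2 * a := by
  rw [← norm_inv_mul_sub_one_eq (hol_unitary hV p s)]
  have e : (hol V p s)⁻¹ * hol V p u = hol V (p + disp s) (revWord s ++ u) := by
    rw [hol_append, disp_revWord, hol_revWord' V (p + disp s) s rfl, show p + disp s + -disp s = p by abel]
  rw [e]
  refine (norm_hol_closed_sub_one_le hV ha hVa _ _ ?_).trans (le_of_eq ?_)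
  · rw [disp_append, disp_revWord, h, neg_add_cancel]
  · rw [List.length_append, length_revWord]

/-- **TREE IN, STEPS, TREE OUT**: `V(treeWord v ++ t ++ rev (treeWord r))` from `p` equals `V(Γ_{p,x})·V_x(t)·V(Γ_{q,·})⁻¹` when
`p + v = x` and the tree from `q` with residue `r` ends where `t` ends. [folklore] -/
theorem hol_tree_mid (V : Site d → Fin d → (Matrix n n ℂ)ˣ) {p x q : Site d} (v r : Site d) (t : List (Letter d))
    (hx : p + v = x) (hq : q + r = x + disp t) :
    hol V p (treeWord v ++ t ++ revWord (treeWord r)) = hol V p (treeWord v) * hol V x t * (hol V q (treeWord r))⁻¹ := by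
  rw [hol_append, hol_append, disp_append, disp_treeWord, show p + (v + disp t) = x + disp t by rw [← add_assoc, hx], hx,
    hol_revWord' V (x + disp t) (treeWord r) (by rw [disp_treeWord, hq])]

omit [Fintype n] [DecidableEq n] in
/-- The length budget of the corner discrepancy loops: `kL + (l1 (cmod L p) + j + l1 (cmod L p′)) ≤ 8dL` for `k, j ≤ 3`
(`d, L ≥ 1`). [folklore] -/
theorem wordLen_le {L : ℕ} (hL : 1 ≤ L) (hd : 1 ≤ d) (p p' : Site d) {k j : ℕ} (hk : k ≤ 3) (hj : j ≤ 3) :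
    ((k * L + (l1 (cmod L p) + j + l1 (cmod L p')) : ℕ) : ℝ) ≤ 8 * d * L := by
  have h1 := l1_cmod_le (d := d) hL p
  have h2 := l1_cmod_le (d := d) hL p'
  have h3 : L ≤ d * L := by nlinarith
  have h4 : k * L ≤ 3 * L := Nat.mul_le_mul_right L hk
  have : k * L + (l1 (cmod L p) + j + l1 (cmod L p')) ≤ 8 * (d * L) := by omega
  calc ((k * L + (l1 (cmod L p) + j + l1 (cmod L p')) : ℕ) : ℝ) ≤ ((8 * (d * L) : ℕ) : ℝ) := by exact_mod_cast this
    _ = 8 * d * L := by push_cast; ring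

/-- **ONE TERM OF THE CORNER COMPARISON**: if the fine dressing is `V(u)` and the straight coarse dressing is `V(s)` from the
same point with `disp u = disp s`, `|s| + |u| ≤ 8dL`, and the averaged dressing `B` is within `12·loopRad` of `V(s)`, then
`‖Ad_{V(u)} X − Ad_B X‖ ≤ 2·((8dL)²a + 12·loopRad)·‖X‖`. [folklore] -/
theorem norm_Ad_term_le [Nonempty n] {L : ℕ} {V : Site d → Fin d → (Matrix n n ℂ)ˣ} (hV : IsUnitaryCfg V) {a : ℝ} (ha : 0 ≤ a)
    (hVa : SmallField V a) {p : Site d} {s u : List (Letter d)} (hdisp : disp u = disp s)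
    (hlen : ((s.length + u.length : ℕ) : ℝ) ≤ 8 * d * L) {B : (Matrix n n ℂ)ˣ} (hB : B ∈ unitaryUnits (Matrix n n ℂ))
    (hSB : ‖((hol V p s : (Matrix n n ℂ)ˣ) : Matrix n n ℂ) - B‖ ≤ 12 * loopRad d L a) (X : Matrix n n ℂ) :
    ‖Ad (hol V p u) X - Ad B X‖ ≤ 2 * ((8 * d * L) ^ 2 * a + 12 * loopRad d L a) * ‖X‖ := by
  have hA := hol_unitary hV p u
  refine (norm_Ad_sub_Ad_le hA hB X).trans ?_
  rw [norm_inv_mul_sub_one_eq hB]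
  have h1 : ‖((hol V p u : (Matrix n n ℂ)ˣ) : Matrix n n ℂ) - B‖
      ≤ ‖((hol V p u : (Matrix n n ℂ)ˣ) : Matrix n n ℂ) - (hol V p s : (Matrix n n ℂ)ˣ)‖
        + ‖((hol V p s : (Matrix n n ℂ)ˣ) : Matrix n n ℂ) - B‖ := norm_sub_le_norm_sub_add_norm_sub _ _ _
  have h2 := norm_hol_sub_hol_le hV ha hVa p s u hdisp
  have h3 : ((s.length + u.length : ℕ) : ℝ) ^ 2 * a ≤ (8 * d * L) ^ 2 * a :=
    mul_le_mul_of_nonneg_right (pow_le_pow_left₀ (Nat.cast_nonneg _) hlen 2) ha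
  have hX := norm_nonneg X
  have : ‖((hol V p u : (Matrix n n ℂ)ˣ) : Matrix n n ℂ) - B‖ ≤ (8 * d * L) ^ 2 * a + 12 * loopRad d L a := by linarith
  nlinarith

/-! ## §3 The corner plaquettes -/

/-- **THE CORNER PLAQUETTE = THE TRANSPLANTED COARSE CURL + `O(a)`**: for `L ≥ 1`, `d ≥ 1`, unitary `V ∈ SmallField V a` with
`512(d+1)(d+4)L²a ≤ 1`, a coarse direction `φ`, and a fine plaquette `(x; μ, ν)`, `μ ≠ ν`, whose `μ`-bonds AND `ν`-bonds cross
(`z := cdiv L x`):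
`‖Ad (btree L V z x) ((d_V (spreadLift L V φ))(x; μ, ν)) − (d_{cavg L V} φ)(z; μ, ν)‖`
`≤ 2·((8dL)²·a + 12·loopRad d L a)·(‖φ z μ‖ + ‖φ (z+e_μ) ν‖ + ‖φ (z+e_ν) μ‖ + ‖φ z ν‖)`. [folklore] -/
theorem norm_Ad_btree_curlAt_spreadLift_sub_le [Nonempty n] {L : ℕ} (hL : 1 ≤ L) (hd : 1 ≤ d)
    {V : Site d → Fin d → (Matrix n n ℂ)ˣ} (hV : IsUnitaryCfg V) {a : ℝ} (ha : 0 ≤ a)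
    (h512 : 512 * (d + 1) * (d + 4) * (L : ℝ) ^ 2 * a ≤ 1) (hVa : SmallField V a)
    (φ : Site d → Fin d → Matrix n n ℂ) {x : Site d} {μ ν : Fin d} (hμν : μ ≠ ν) (hμ : IsCross L x μ) (hν : IsCross L x ν) :
    ‖Ad (btree L V (cdiv L x) x) (curlAt V (spreadLift L V φ) x μ ν) - curlAt (cavg L V) φ (cdiv L x) μ ν‖
      ≤ 2 * ((8 * d * L) ^ 2 * a + 12 * loopRad d L a)
        * (‖φ (cdiv L x) μ‖ + ‖φ (cdiv L x + e μ) ν‖ + ‖φ (cdiv L x + e ν) μ‖ + ‖φ (cdiv L x) ν‖) := by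
  set z : Site d := cdiv L x with hz
  -- block bookkeeping
  have hxz : (L : ℤ) • z + cmod L x = x := smul_cdiv_add_cmod (L := L) x
  have hcm : cmod L x = x - (L : ℤ) • z := eq_sub_of_add_eq' hxz
  have hν' : IsCross L (x + e μ) ν := (isCross_add_e_iff x (Ne.symm hμν)).mpr hν
  have hμ' : IsCross L (x + e ν) μ := (isCross_add_e_iff x hμν).mpr hμ
  have hc1 : cdiv L (x + e μ) = z + e μ := cdiv_add_e_of_isCross hL hμ
  have hc2 : cdiv L (x + e ν) = z + e ν := cdiv_add_e_of_isCross hL hν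
  -- the four entered corners and residues: `q_i + r_i = end point of bond i`
  have hq1 : exitCorner L x μ = (L : ℤ) • z + (L : ℤ) • e μ := by unfold SpreadLiftDirection.exitCorner; rw [← hz, smul_add]
  have hq2 : exitCorner L (x + e μ) ν = (L : ℤ) • z + (L : ℤ) • e μ + (L : ℤ) • e ν := by
    unfold SpreadLiftDirection.exitCorner; rw [hc1, smul_add, smul_add]
  have hq3 : exitCorner L (x + e ν) μ = (L : ℤ) • z + (L : ℤ) • e ν + (L : ℤ) • e μ := by
    unfold SpreadLiftDirection.exitCorner; rw [hc2, smul_add, smul_add]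
  have hq4 : exitCorner L x ν = (L : ℤ) • z + (L : ℤ) • e ν := by unfold SpreadLiftDirection.exitCorner; rw [← hz, smul_add]
  have hr1 : cmod L (x + e μ) = x + e μ - exitCorner L x μ := (add_e_sub_exitCorner hL hμ).symm
  have hr2 : cmod L (x + e μ + e ν) = x + e μ + e ν - exitCorner L (x + e μ) ν := (add_e_sub_exitCorner hL hν').symm
  have hr3 : cmod L (x + e ν + e μ) = x + e ν + e μ - exitCorner L (x + e ν) μ := (add_e_sub_exitCorner hL hμ').symm
  have hr4 : cmod L (x + e ν) = x + e ν - exitCorner L x ν := (add_e_sub_exitCorner hL hν).symm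
  -- the four dressings
  set T₁ : (Matrix n n ℂ)ˣ := hol V (exitCorner L x μ) (treeWord (cmod L (x + e μ))) with hT₁
  set T₂ : (Matrix n n ℂ)ˣ := hol V (exitCorner L (x + e μ) ν) (treeWord (cmod L (x + e μ + e ν))) with hT₂
  set T₃ : (Matrix n n ℂ)ˣ := hol V (exitCorner L (x + e ν) μ) (treeWord (cmod L (x + e ν + e μ))) with hT₃
  set T₄ : (Matrix n n ℂ)ˣ := hol V (exitCorner L x ν) (treeWord (cmod L (x + e ν))) with hT₄
  have hψ1 : spreadLift L V φ x μ = Ad T₁⁻¹ (φ z μ) := by rw [spreadLift_of_isCross L V φ hμ, crossHol_eq hL V hμ]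
  have hψ2 : spreadLift L V φ (x + e μ) ν = Ad T₂⁻¹ (φ (z + e μ) ν) := by
    rw [spreadLift_of_isCross L V φ hν', crossHol_eq hL V hν', hc1]
  have hψ3 : spreadLift L V φ (x + e ν) μ = Ad T₃⁻¹ (φ (z + e ν) μ) := by
    rw [spreadLift_of_isCross L V φ hμ', crossHol_eq hL V hμ', hc2]
  have hψ4 : spreadLift L V φ x ν = Ad T₄⁻¹ (φ z ν) := by rw [spreadLift_of_isCross L V φ hν, crossHol_eq hL V hν]
  -- the block tree transport to the corner frame
  set P : (Matrix n n ℂ)ˣ := hol V ((L : ℤ) • z) (treeWord (cmod L x)) with hP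
  have hPb : btree L V z x = P := by unfold AveragingDeficitBlockDensity.btree; rw [hP, hcm]
  -- the four fine dressings as single words from the corner `L•z`
  set u₁ : List (Letter d) := treeWord (cmod L x) ++ [(μ, true)] ++ revWord (treeWord (cmod L (x + e μ))) with hu₁
  set u₂ : List (Letter d) := treeWord (cmod L x) ++ [(μ, true), (ν, true)] ++ revWord (treeWord (cmod L (x + e μ + e ν))) with hu₂
  set u₃ : List (Letter d) := treeWord (cmod L x) ++ [(μ, true), (ν, true)] ++ revWord (treeWord (cmod L (x + e ν + e μ))) with hu₃
  set u₄ : List (Letter d) := treeWord (cmod L x) ++ [(μ, true), (ν, true), (μ, false)] ++ revWord (treeWord (cmod L (x + e ν)))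
    with hu₄
  have hA1 : hol V ((L : ℤ) • z) u₁ = P * V x μ * T₁⁻¹ := by
    rw [hu₁, hol_tree_mid V (q := exitCorner L x μ) (cmod L x) (cmod L (x + e μ)) _ hxz
      (by rw [hr1]; simp only [disp_cons, disp_nil, Letter.vec_true, add_zero]; abel)]
    simp only [hol_cons, hol_nil, stepHol_true, mul_one, hP, hT₁]
  have hA2 : hol V ((L : ℤ) • z) u₂ = P * V x μ * V (x + e μ) ν * T₂⁻¹ := by
    rw [hu₂, hol_tree_mid V (q := exitCorner L (x + e μ) ν) (cmod L x) (cmod L (x + e μ + e ν)) _ hxz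
      (by rw [hr2]; simp only [disp_cons, disp_nil, Letter.vec_true, add_zero]; abel)]
    simp only [hol_cons, hol_nil, stepHol_true, Letter.vec_true, mul_one, mul_assoc, hP, hT₂]
  have hA3 : hol V ((L : ℤ) • z) u₃ = P * V x μ * V (x + e μ) ν * T₃⁻¹ := by
    rw [hu₃, hol_tree_mid V (q := exitCorner L (x + e ν) μ) (cmod L x) (cmod L (x + e ν + e μ)) _ hxz
      (by rw [hr3]; simp only [disp_cons, disp_nil, Letter.vec_true, add_zero]; abel)]
    simp only [hol_cons, hol_nil, stepHol_true, Letter.vec_true, mul_one, mul_assoc, hP, hT₃]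
  have hA4 : hol V ((L : ℤ) • z) u₄ = P * V x μ * V (x + e μ) ν * (V (x + e ν) μ)⁻¹ * T₄⁻¹ := by
    rw [hu₄, hol_tree_mid V (q := exitCorner L x ν) (cmod L x) (cmod L (x + e ν)) _ hxz
      (by rw [hr4]; simp only [disp_cons, disp_nil, Letter.vec_true, Letter.vec_false, add_zero]; abel)]
    simp only [hol_cons, hol_nil, stepHol_true, stepHol_false, Letter.vec_true, Letter.vec_false, ← sub_eq_add_neg, mul_one,
      mul_assoc, hP, hT₄, show x + e μ + e ν - e μ = x + e ν by abel]
  -- the three straight coarse dressings as single words from `L•z`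
  set s₁ : List (Letter d) := seg μ (L : ℤ) with hs₁
  set s₂ : List (Letter d) := seg μ (L : ℤ) ++ seg ν (L : ℤ) with hs₂
  set s₄ : List (Letter d) := seg μ (L : ℤ) ++ seg ν (L : ℤ) ++ revWord (seg μ (L : ℤ)) with hs₄
  have hS1 : hol V ((L : ℤ) • z) s₁ = bseg L V z μ := rfl
  have hS2 : hol V ((L : ℤ) • z) s₂ = bseg L V z μ * bseg L V (z + e μ) ν := by
    rw [hs₂, hol_append, disp_seg, ← smul_add]; rfl
  have hS4 : hol V ((L : ℤ) • z) s₄ = bseg L V z μ * bseg L V (z + e μ) ν * (bseg L V (z + e ν) μ)⁻¹ := by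
    rw [hs₄, hol_append, hol_append, disp_append, disp_seg, disp_seg, ← smul_add,
      hol_revWord' V (x := (L : ℤ) • (z + e ν)) ((L : ℤ) • z + ((L : ℤ) • e μ + (L : ℤ) • e ν)) (seg μ (L : ℤ))
        (by rw [disp_seg, smul_add]; abel)]
    rfl
  -- displacements agree, lengths are `≤ 8dL`
  have hLn : ((L : ℤ).natAbs : ℕ) = L := Int.natAbs_natCast L
  have hd1 : disp u₁ = disp s₁ := by
    simp only [hu₁, hs₁, disp_append, disp_cons, disp_nil, disp_treeWord, disp_revWord, disp_seg, Letter.vec_true, add_zero,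
      hcm, hr1, hq1]; abel
  have hd2 : disp u₂ = disp s₂ := by
    simp only [hu₂, hs₂, disp_append, disp_cons, disp_nil, disp_treeWord, disp_revWord, disp_seg, Letter.vec_true, add_zero,
      hcm, hr2, hq2]; abel
  have hd3 : disp u₃ = disp s₂ := by
    simp only [hu₃, hs₂, disp_append, disp_cons, disp_nil, disp_treeWord, disp_revWord, disp_seg, Letter.vec_true, add_zero,
      hcm, hr3, hq3]; abel
  have hd4 : disp u₄ = disp s₄ := by
    simp only [hu₄, hs₄, disp_append, disp_cons, disp_nil, disp_treeWord, disp_revWord, disp_seg, Letter.vec_true,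
      Letter.vec_false, add_zero, hcm, hr4, hq4]; abel
  have hl1 : ((s₁.length + u₁.length : ℕ) : ℝ) ≤ 8 * d * L := by
    have e : s₁.length + u₁.length = 1 * L + (l1 (cmod L x) + 1 + l1 (cmod L (x + e μ))) := by
      simp only [hs₁, hu₁, List.length_append, length_seg, hLn, length_treeWord, List.length_cons, List.length_nil,
        length_revWord]; ring
    rw [e]; exact wordLen_le hL hd _ _ (by norm_num) (by norm_num)
  have hl2 : ((s₂.length + u₂.length : ℕ) : ℝ) ≤ 8 * d * L := by
    have e : s₂.length + u₂.length = 2 * L + (l1 (cmod L x) + 2 + l1 (cmod L (x + e μ + e ν))) := by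
      simp only [hs₂, hu₂, List.length_append, length_seg, hLn, length_treeWord, List.length_cons, List.length_nil,
        length_revWord]; ring
    rw [e]; exact wordLen_le hL hd _ _ (by norm_num) (by norm_num)
  have hl3 : ((s₂.length + u₃.length : ℕ) : ℝ) ≤ 8 * d * L := by
    have e : s₂.length + u₃.length = 2 * L + (l1 (cmod L x) + 2 + l1 (cmod L (x + e ν + e μ))) := by
      simp only [hs₂, hu₃, List.length_append, length_seg, hLn, length_treeWord, List.length_cons, List.length_nil,
        length_revWord]; ring
    rw [e]; exact wordLen_le hL hd _ _ (by norm_num) (by norm_num)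
  have hl4 : ((s₄.length + u₄.length : ℕ) : ℝ) ≤ 8 * d * L := by
    have e : s₄.length + u₄.length = 3 * L + (l1 (cmod L x) + 3 + l1 (cmod L (x + e ν))) := by
      simp only [hs₄, hu₄, List.length_append, length_seg, hLn, length_treeWord, List.length_cons, List.length_nil,
        length_revWord]; ring
    rw [e]; exact wordLen_le hL hd _ _ (by norm_num) (by norm_num)
  -- the averaged dressings are within `12·loopRad` of the straight ones
  have hw0 : 0 ≤ loopRad d L a := by unfold SpreadLift.loopRad; positivity
  have hB1u : cavg L V z μ ∈ unitaryUnits (Matrix n n ℂ) := cavg_mem hL hV ha h512 hVa z μ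
  have hB2u : cavg L V z μ * cavg L V (z + e μ) ν ∈ unitaryUnits (Matrix n n ℂ) :=
    (unitaryUnits _).mul_mem hB1u (cavg_mem hL hV ha h512 hVa _ ν)
  have hB4u : cavg L V z μ * cavg L V (z + e μ) ν * (cavg L V (z + e ν) μ)⁻¹ ∈ unitaryUnits (Matrix n n ℂ) :=
    (unitaryUnits _).mul_mem hB2u ((unitaryUnits _).inv_mem (cavg_mem hL hV ha h512 hVa _ μ))
  have hSB1 : ‖((hol V ((L : ℤ) • z) s₁ : (Matrix n n ℂ)ˣ) : Matrix n n ℂ) - (cavg L V z μ : (Matrix n n ℂ)ˣ)‖ ≤ 12 * loopRad d L a := by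
    rw [hS1]; linarith [norm_bseg_sub_cavg_le hL hV ha h512 hVa z μ]
  have hSB2 : ‖((hol V ((L : ℤ) • z) s₂ : (Matrix n n ℂ)ˣ) : Matrix n n ℂ) - (cavg L V z μ * cavg L V (z + e μ) ν : (Matrix n n ℂ)ˣ)‖
      ≤ 12 * loopRad d L a := by
    rw [hS2]; linarith [norm_bseg₂_sub_cavg₂_le hL hV ha h512 hVa z (z + e μ) μ ν]
  have hSB4 : ‖((hol V ((L : ℤ) • z) s₄ : (Matrix n n ℂ)ˣ) : Matrix n n ℂ)
      - (cavg L V z μ * cavg L V (z + e μ) ν * (cavg L V (z + e ν) μ)⁻¹ : (Matrix n n ℂ)ˣ)‖ ≤ 12 * loopRad d L a := by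
    rw [hS4]; exact norm_bseg₃_sub_cavg₃_le hL hV ha h512 hVa z (z + e μ) (z + e ν) μ ν
  -- the four term bounds
  have t1 := norm_Ad_term_le hV ha hVa hd1 hl1 hB1u hSB1 (φ z μ)
  have t2 := norm_Ad_term_le hV ha hVa hd2 hl2 hB2u hSB2 (φ (z + e μ) ν)
  have t3 := norm_Ad_term_le hV ha hVa hd3 hl3 hB2u hSB2 (φ (z + e ν) μ)
  have t4 := norm_Ad_term_le hV ha hVa hd4 hl4 hB4u hSB4 (φ z ν)
  rw [hA1] at t1; rw [hA2] at t2; rw [hA3] at t3; rw [hA4] at t4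
  -- expand both curls and regroup
  have hexp : Ad (btree L V z x) (curlAt V (spreadLift L V φ) x μ ν) - curlAt (cavg L V) φ z μ ν
      = (Ad (P * V x μ * T₁⁻¹) (φ z μ) - Ad (cavg L V z μ) (φ z μ))
        + (Ad (P * V x μ * V (x + e μ) ν * T₂⁻¹) (φ (z + e μ) ν) - Ad (cavg L V z μ * cavg L V (z + e μ) ν) (φ (z + e μ) ν))
        - (Ad (P * V x μ * V (x + e μ) ν * T₃⁻¹) (φ (z + e ν) μ) - Ad (cavg L V z μ * cavg L V (z + e μ) ν) (φ (z + e ν) μ))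
        - (Ad (P * V x μ * V (x + e μ) ν * (V (x + e ν) μ)⁻¹ * T₄⁻¹) (φ z ν)
            - Ad (cavg L V z μ * cavg L V (z + e μ) ν * (cavg L V (z + e ν) μ)⁻¹) (φ z ν)) := by
    rw [hPb]
    simp only [curlAt, hψ1, hψ2, hψ3, hψ4, Ad_add, Ad_sub, Ad_mul]
    abel
  rw [hexp]
  have hK : 0 ≤ 2 * ((8 * (d : ℝ) * L) ^ 2 * a + 12 * loopRad d L a) := by positivity
  calc _ ≤ ‖Ad (P * V x μ * T₁⁻¹) (φ z μ) - Ad (cavg L V z μ) (φ z μ)‖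
        + ‖Ad (P * V x μ * V (x + e μ) ν * T₂⁻¹) (φ (z + e μ) ν) - Ad (cavg L V z μ * cavg L V (z + e μ) ν) (φ (z + e μ) ν)‖
        + ‖Ad (P * V x μ * V (x + e μ) ν * T₃⁻¹) (φ (z + e ν) μ) - Ad (cavg L V z μ * cavg L V (z + e μ) ν) (φ (z + e ν) μ)‖
        + ‖Ad (P * V x μ * V (x + e μ) ν * (V (x + e ν) μ)⁻¹ * T₄⁻¹) (φ z ν)
            - Ad (cavg L V z μ * cavg L V (z + e μ) ν * (cavg L V (z + e ν) μ)⁻¹) (φ z ν)‖ := by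
          refine (norm_sub_le _ _).trans ?_
          refine add_le_add ((norm_sub_le _ _).trans (add_le_add ((norm_add_le _ _).trans le_rfl) le_rfl)) le_rfl
    _ ≤ _ := by linarith

/-- **FRAME-FREE COROLLARY**: `‖(d_V (spreadLift L V φ))(x; μ, ν)‖ ≤ ‖(d_{cavg L V} φ)(z; μ, ν)‖ + K·(four coarse norms)` at a
corner plaquette (`Ad` by the unitary `btree` is an isometry). [folklore] -/
theorem norm_curlAt_spreadLift_corner_le [Nonempty n] {L : ℕ} (hL : 1 ≤ L) (hd : 1 ≤ d)
    {V : Site d → Fin d → (Matrix n n ℂ)ˣ} (hV : IsUnitaryCfg V) {a : ℝ} (ha : 0 ≤ a)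
    (h512 : 512 * (d + 1) * (d + 4) * (L : ℝ) ^ 2 * a ≤ 1) (hVa : SmallField V a)
    (φ : Site d → Fin d → Matrix n n ℂ) {x : Site d} {μ ν : Fin d} (hμν : μ ≠ ν) (hμ : IsCross L x μ) (hν : IsCross L x ν) :
    ‖curlAt V (spreadLift L V φ) x μ ν‖
      ≤ ‖curlAt (cavg L V) φ (cdiv L x) μ ν‖ + 2 * ((8 * d * L) ^ 2 * a + 12 * loopRad d L a)
        * (‖φ (cdiv L x) μ‖ + ‖φ (cdiv L x + e μ) ν‖ + ‖φ (cdiv L x + e ν) μ‖ + ‖φ (cdiv L x) ν‖) := by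
  have h := norm_Ad_btree_curlAt_spreadLift_sub_le hL hd hV ha h512 hVa φ hμν hμ hν
  have hP : btree L V (cdiv L x) x ∈ unitaryUnits (Matrix n n ℂ) := hol_unitary hV _ _
  rw [← norm_Ad_of_unitary hP (curlAt V (spreadLift L V φ) x μ ν)]
  have h2 := norm_le_insert' (Ad (btree L V (cdiv L x) x) (curlAt V (spreadLift L V φ) x μ ν)) (curlAt (cavg L V) φ (cdiv L x) μ ν)
  linarith

end

end Summit.QuantumFields.BalabanUV.T4Continuum.NE3SpreadLiftCurlCorner
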